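import Summits.CriticalPhenomena.Ising3DConformalLimit.Theses.CurrentConnectionInvariance
import Summits.CriticalPhenomena.Ising3DConformalLimit.Theorems.FKParityRobustnessFarMergingGivesU4
import Literature.Probability.LatticeModels.SourcedDoubleCurrentsSwitching
import Literature.Probability.LatticeModels.CriticalUrsellFourSign
import HarnessLib

/-!
# Line `current-merging-split` for crux `NormalisedU4Nonvanishing` (stmt-CriticalPhenomena-4843):
# crux ⟸ LimitExists (item 4738) ∧ ADC21 (3.11) in infinite volume ∧ far merging of sourced double currents

Route `CurrentConnectionInvariance` (sub-problem `Ising3DConformalLimit`); crux strategist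
planner-cstrat-stmt-CriticalPhenomena-4843-r1-0, 2026-08-17 (RESTATED re-audit bin, BC2 redirect).

The crux (Δ-free, ρ-free lattice non-Gaussianity at one continuum configuration, frequently in the
mesh) is decomposed in two layers, every composition PROVED here (sorries only in `stub_*`):

* TYPED SPLIT (route level): `NormalisedU4Nonvanishing ⟸ LimitExists ∧ NonGaussianLimit`
  (`normalisedU4Nonvanishing_of_limit`, a genuine limit argument: along the full filter
  `ρ⁴U₄^δ(x) → U₄(S)(x) ≠ 0`, `ρ⁴G₂G₂ → S₂S₂ > 0`, the weights cancel in the ratio, eventually ⇒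
  frequently), with the converse calibration `nonGaussianLimit_of_normalisedU4Nonvanishing`
  (piece 2 is a consequence of the crux).  Pieces = shared items stmt-CriticalPhenomena-4738
  (`LimitExists`, verbatim = `stub_limitExists`) and stmt-CriticalPhenomena-0636 (`NonGaussianLimit`).
* THIS ROUTE'S MECHANISM for piece 2: `NonGaussianLimit ⟸ stub_switchingInfiniteVolume ∧
  stub_sourcedCurrentsMergeIO` (`NonGaussianLimit_of`): Aizenman's identity
  `U₄ = −2⟨σσ⟩⟨σσ⟩·P^{xy,zt}_{β_c}[x ↔ z]` in infinite volume (ADC21 (3.11), the tree's named fact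
  `freeUrsellFour_eq_sourcedDoubleCurrent 3`) turns far merging OF THE SOURCED DOUBLE CURRENTS along
  infinitely many dilations of an injective lattice shape into Aizenman far merging
  `U₄(Lx) ≤ −2c⟨σσ⟩⟨σσ⟩`, and the landed `farMergingGivesU4_proof` (item stmt-CriticalPhenomena-4471)
  transfers it to every non-degenerate pointwise scaling limit.
* `NormalisedU4Nonvanishing_of : stub_limitExists-sig → stub_switchingInfiniteVolume-sig →
  stub_sourcedCurrentsMergeIO-sig → NormalisedU4Nonvanishing` — the line's kernel-checked composition.

Stubs: `stub_limitExists` (= item 4738; OPEN, owned by the covariance routes / this route's (T)+(L)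
reconstruction), `stub_switchingInfiniteVolume` (ADC21 (3.11) at `β ≤ β_c` on `ℤ³` in infinite
volume: finite volume PROVED as `connectedFour_free_box_eq`; content = no infinite cluster of the
sourced current at `β_c`, ADS2015 / ADC21 footnote 5; M–L), `stub_sourcedCurrentsMergeIO` (THE HARD
ONE: 3D non-triviality in percolation language; XL).

References: M. Aizenman, Comm. Math. Phys. 86 (1982) [AizenmanCMP1982]; M. Aizenman, H. Duminil-Copin,
Ann. of Math. 194 (2021) = arXiv:1912.07973, §3.2 (3.10)–(3.12), Lemma 4.4 [AizenmanDuminilCopinAnnals2021];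
M. Aizenman, H. Duminil-Copin, V. Sidoravicius, Comm. Math. Phys. 334 (2015) [AizenmanDuminilCopinSidoraviciusCMP2015];
H. Duminil-Copin, ICM 2022 §6.4, §8.4 [DuminilCopinICM2022].
-/

noncomputable section

open Filter Topology Finset
open scoped symmDiff
open Literature.Probability.LatticeModels Literature.Probability.Percolation
open Summit.CriticalPhenomena.Ising3DConformalLimit.FKParityRobustnessFarMergingGivesU4 (farMergingGivesU4_proof)

namespace Summit.CriticalPhenomena.Ising3DConformalLimit.Cruxes.NormalisedU4Nonvanishing.CurrentMergingSplit

/-! ### The three stub statements (line vocabulary) -/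

/-- Piece 1 of the split, verbatim item stmt-CriticalPhenomena-4738 `LimitExists`. -/
def LimitExistsP : Prop :=
  ∃ (ρ : ℝ → ℝ) (S : CorrFamily 3), (∀ δ ∈ Set.Ioc (0 : ℝ) 1, 0 < ρ δ) ∧
    HasPointwiseScalingLimit (criticalCorr 3) ρ S ∧ IsNondegenerateTwoPoint S

/-- Piece 2 of the split, verbatim item stmt-CriticalPhenomena-0636 `NonGaussianLimit`. -/
def NonGaussianLimitP : Prop :=
  ∀ (ρ : ℝ → ℝ) (S : CorrFamily 3), (∀ δ ∈ Set.Ioc (0 : ℝ) 1, 0 < ρ δ) →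
    HasPointwiseScalingLimit (criticalCorr 3) ρ S → IsNondegenerateTwoPoint S → HasNontrivialU4 S

/-- ADC21 (3.11) on `ℤ³` in infinite volume (the tree's named fact). -/
def SwitchingInfiniteVolumeP : Prop := freeUrsellFour_eq_sourcedDoubleCurrent 3

/-- Far merging of the sourced double currents along infinitely many dilations of an injective
lattice shape. -/
def SourcedCurrentsMergeIOP : Prop :=
  ∃ x : Fin 4 → Site 3, Function.Injective x ∧ ∃ c : ℝ, 0 < c ∧ ∀ L₀ : ℕ, ∃ L : ℕ, L₀ ≤ L ∧
    c ≤ (sourcedDoubleCurrentLawInf 3 (criticalBeta 3) ({(L : ℤ) • x 0} ∆ {(L : ℤ) • x 1})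
      ({(L : ℤ) • x 2} ∆ {(L : ℤ) • x 3})).real (openConn ((L : ℤ) • x 0) ((L : ℤ) • x 2))

/-! ### Name-keyed aliases of the registered stubs (the hypotheses of the composition) -/
namespace Registered

/-- Alias of `LimitExistsP` keyed by the registered stub name. -/
abbrev stub_limitExists : Prop := LimitExistsP
/-- Alias of `SwitchingInfiniteVolumeP` keyed by the registered stub name. -/
abbrev stub_switchingInfiniteVolume : Prop := SwitchingInfiniteVolumeP
/-- Alias of `SourcedCurrentsMergeIOP` keyed by the registered stub name. -/
abbrev stub_sourcedCurrentsMergeIO : Prop := SourcedCurrentsMergeIOP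

end Registered

/-! ### Registered stubs (`sorry` lives ONLY here) -/

/-- STUB 1 — `LimitExists`, verbatim item stmt-CriticalPhenomena-4738 (piece 1 of the split): a
non-degenerate pointwise scaling limit of the critical correlators on `ℤ³` exists. OPEN. -/
theorem stub_limitExists : LimitExistsP := by
  sorry

/-- STUB 2 — ADC21 (3.11) on `ℤ³` in infinite volume at `β ≤ β_c` (the tree's named fact; the
`L → ∞` passage on the non-local event `{x ↔ z}`). -/
theorem stub_switchingInfiniteVolume : SwitchingInfiniteVolumeP := by
  sorry

/-- STUB 3 — FAR MERGING OF THE SOURCED DOUBLE CURRENTS: for some injective lattice shape `x` and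
`c > 0`, along infinitely many dilations `L`, the sourced double current with sources
`{Lx₀,Lx₁}`, `{Lx₂,Lx₃}` connects `Lx₀` to `Lx₂` with probability `≥ c`. OPEN (3D non-triviality). -/
theorem stub_sourcedCurrentsMergeIO : SourcedCurrentsMergeIOP := by
  sorry


open Summit.CriticalPhenomena.Ising3DConformalLimit.Theses.CurrentConnectionInvariance (NormalisedU4Nonvanishing)

/-! ### Elementary lemmas -/

/-- `![a, b]` is injective as soon as `a ≠ b`. [folklore] -/
theorem injective_vecCons_pair {α : Type*} {a b : α} (h : a ≠ b) : Function.Injective ![a, b] := by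
  intro i j hij
  fin_cases i <;> fin_cases j
  · rfl
  · exact absurd hij (by simpa using h)
  · exact absurd hij (by simpa using h.symm)
  · rfl

/-- The weights factor out: `rescaledCorrelator G ρ n δ y = ρ(δ)ⁿ · rescaledCorrelator G 1 n δ y`
(the `ρ ≡ 1` correlator is the bare lattice correlator at the sites `[yᵢ/δ]`). [folklore] -/
theorem rescaledCorrelator_eq_pow_mul {d : ℕ} (G : LatticeCorrFamily d) (ρ : ℝ → ℝ) (n : ℕ) (δ : ℝ)
    (y : Fin n → EuclideanSpace ℝ (Fin d)) :
    rescaledCorrelator G ρ n δ y = ρ δ ^ n * rescaledCorrelator G 1 n δ y := by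
  simp [rescaledCorrelator_apply]

/-- Meshes in `(0,1]` are eventual for `δ → 0⁺`. [folklore] -/
theorem eventually_mem_Ioc : ∀ᶠ δ in 𝓝[>] (0 : ℝ), δ ∈ Set.Ioc (0 : ℝ) 1 :=
  Ioc_mem_nhdsGT one_pos

section limit

variable {ρ : ℝ → ℝ} {S : CorrFamily 3}

/-- Convergence of the rescaled `n`-point correlator at a non-coincident configuration, written with
the weight factored out. [folklore] -/
theorem tendsto_pow_mul_rescaledCorrelator (hlim : HasPointwiseScalingLimit (criticalCorr 3) ρ S)
    {n : ℕ} {y : Fin n → EuclideanSpace ℝ (Fin 3)} (hy : y ∈ NonCoincident 3 n) :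
    Tendsto (fun δ : ℝ => ρ δ ^ n * rescaledCorrelator (criticalCorr 3) 1 n δ y) (𝓝[>] (0 : ℝ))
      (𝓝 (S n y)) := by
  refine ((hlim n).tendsto_at hy).congr fun δ => ?_
  exact rescaledCorrelator_eq_pow_mul (criticalCorr 3) ρ n δ y

/-- The rescaled lattice Ursell function at `x` converges to the continuum one, and the rescaled
normalisation `G^δ₂(x₀,x₁)G^δ₂(x₂,x₃)` to `S₂S₂`. [folklore] -/
theorem tendsto_U4_and_GG (hlim : HasPointwiseScalingLimit (criticalCorr 3) ρ S)
    {x : Fin 4 → EuclideanSpace ℝ (Fin 3)} (hx : x ∈ NonCoincident 3 4) :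
    Tendsto (fun δ : ℝ => ρ δ ^ 4 *
        (rescaledCorrelator (criticalCorr 3) 1 4 δ x -
          (rescaledCorrelator (criticalCorr 3) 1 2 δ ![x 0, x 1] * rescaledCorrelator (criticalCorr 3) 1 2 δ ![x 2, x 3] +
            rescaledCorrelator (criticalCorr 3) 1 2 δ ![x 0, x 2] * rescaledCorrelator (criticalCorr 3) 1 2 δ ![x 1, x 3] +
            rescaledCorrelator (criticalCorr 3) 1 2 δ ![x 0, x 3] * rescaledCorrelator (criticalCorr 3) 1 2 δ ![x 1, x 2])))
        (𝓝[>] (0 : ℝ)) (𝓝 (limitConnectedFour S x)) ∧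
      Tendsto (fun δ : ℝ => ρ δ ^ 4 *
        (rescaledCorrelator (criticalCorr 3) 1 2 δ ![x 0, x 1] * rescaledCorrelator (criticalCorr 3) 1 2 δ ![x 2, x 3]))
        (𝓝[>] (0 : ℝ)) (𝓝 (S 2 ![x 0, x 1] * S 2 ![x 2, x 3])) := by
  have hxinj : Function.Injective x := hx
  have h4 := tendsto_pow_mul_rescaledCorrelator hlim hx
  have h2 : ∀ a b : Fin 4, a ≠ b →
      Tendsto (fun δ : ℝ => ρ δ ^ 2 * rescaledCorrelator (criticalCorr 3) 1 2 δ ![x a, x b])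
        (𝓝[>] (0 : ℝ)) (𝓝 (S 2 ![x a, x b])) := fun a b hab =>
    tendsto_pow_mul_rescaledCorrelator hlim (injective_vecCons_pair (hxinj.ne hab))
  constructor
  · have h := h4.sub ((((h2 0 1 (by decide)).mul (h2 2 3 (by decide))).add
      ((h2 0 2 (by decide)).mul (h2 1 3 (by decide)))).add
      ((h2 0 3 (by decide)).mul (h2 1 2 (by decide))))
    refine h.congr fun δ => ?_
    ring
  · exact ((h2 0 1 (by decide)).mul (h2 2 3 (by decide))).congr fun δ => by ring

/-- **Pointwise core of the assembly.**  If a non-degenerate pointwise scaling limit `(ρ, S)` has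
`U₄(S)(x) ≠ 0` at a non-coincident `x`, then with `ε = |U₄(S)(x)| / (2 S₂S₂)` the crux's inequality
holds at `x` for ALL small meshes. [folklore] -/
theorem eventually_normalisedU4_of_limit (hρ : ∀ δ ∈ Set.Ioc (0 : ℝ) 1, 0 < ρ δ)
    (hlim : HasPointwiseScalingLimit (criticalCorr 3) ρ S) (hnd : IsNondegenerateTwoPoint S)
    {x : Fin 4 → EuclideanSpace ℝ (Fin 3)} (hx : x ∈ NonCoincident 3 4)
    (hA : limitConnectedFour S x ≠ 0) :
    ∃ ε : ℝ, 0 < ε ∧ ∀ᶠ δ in 𝓝[>] (0 : ℝ),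
      ε * (rescaledCorrelator (criticalCorr 3) 1 2 δ ![x 0, x 1] * rescaledCorrelator (criticalCorr 3) 1 2 δ ![x 2, x 3]) ≤
        |rescaledCorrelator (criticalCorr 3) 1 4 δ x -
          (rescaledCorrelator (criticalCorr 3) 1 2 δ ![x 0, x 1] * rescaledCorrelator (criticalCorr 3) 1 2 δ ![x 2, x 3] +
            rescaledCorrelator (criticalCorr 3) 1 2 δ ![x 0, x 2] * rescaledCorrelator (criticalCorr 3) 1 2 δ ![x 1, x 3] +
            rescaledCorrelator (criticalCorr 3) 1 2 δ ![x 0, x 3] * rescaledCorrelator (criticalCorr 3) 1 2 δ ![x 1, x 2])| := by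
  have hxinj : Function.Injective x := hx
  obtain ⟨hU, hG⟩ := tendsto_U4_and_GG hlim hx
  set A : ℝ := limitConnectedFour S x with hAdef
  set B : ℝ := S 2 ![x 0, x 1] * S 2 ![x 2, x 3] with hBdef
  have hBpos : 0 < B :=
    mul_pos (hnd _ (injective_vecCons_pair (hxinj.ne (by decide))))
      (hnd _ (injective_vecCons_pair (hxinj.ne (by decide))))
  have hApos : 0 < |A| := abs_pos.2 hA
  refine ⟨|A| / (2 * B), div_pos hApos (by positivity), ?_⟩
  have hlt : |A| / (2 * B) * B < |A| := by
    have e : |A| / (2 * B) * B = |A| / 2 := by field_simp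
    rw [e]
    linarith
  have hev := (hG.const_mul (|A| / (2 * B))).eventually_lt hU.abs hlt
  filter_upwards [hev, eventually_mem_Ioc] with δ hδ hmem
  have hρ4 : 0 < ρ δ ^ 4 := pow_pos (hρ δ hmem) 4
  rw [abs_mul, abs_of_pos hρ4] at hδ
  -- `ε · ρ⁴GG < ρ⁴|U₄|`; divide by `ρ⁴ > 0`
  have key : ρ δ ^ 4 * (|A| / (2 * B) *
      (rescaledCorrelator (criticalCorr 3) 1 2 δ ![x 0, x 1] * rescaledCorrelator (criticalCorr 3) 1 2 δ ![x 2, x 3])) <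
      ρ δ ^ 4 * |rescaledCorrelator (criticalCorr 3) 1 4 δ x -
          (rescaledCorrelator (criticalCorr 3) 1 2 δ ![x 0, x 1] * rescaledCorrelator (criticalCorr 3) 1 2 δ ![x 2, x 3] +
            rescaledCorrelator (criticalCorr 3) 1 2 δ ![x 0, x 2] * rescaledCorrelator (criticalCorr 3) 1 2 δ ![x 1, x 3] +
            rescaledCorrelator (criticalCorr 3) 1 2 δ ![x 0, x 3] * rescaledCorrelator (criticalCorr 3) 1 2 δ ![x 1, x 2])| := by
    linarith
  exact (lt_of_mul_lt_mul_left key hρ4.le).le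

/-- **Pointwise core of the converse.**  If the crux's inequality holds at `x` with constant `ε`
frequently as `δ → 0⁺`, then every non-degenerate pointwise scaling limit has
`ε · S₂S₂ ≤ |U₄(S)(x)|`, in particular `U₄(S)(x) ≠ 0`. [folklore] -/
theorem le_abs_limitConnectedFour_of_frequently (hρ : ∀ δ ∈ Set.Ioc (0 : ℝ) 1, 0 < ρ δ)
    (hlim : HasPointwiseScalingLimit (criticalCorr 3) ρ S)
    {x : Fin 4 → EuclideanSpace ℝ (Fin 3)} (hx : x ∈ NonCoincident 3 4) {ε : ℝ}
    (hfreq : ∃ᶠ δ in 𝓝[>] (0 : ℝ),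
      ε * (rescaledCorrelator (criticalCorr 3) 1 2 δ ![x 0, x 1] * rescaledCorrelator (criticalCorr 3) 1 2 δ ![x 2, x 3]) ≤
        |rescaledCorrelator (criticalCorr 3) 1 4 δ x -
          (rescaledCorrelator (criticalCorr 3) 1 2 δ ![x 0, x 1] * rescaledCorrelator (criticalCorr 3) 1 2 δ ![x 2, x 3] +
            rescaledCorrelator (criticalCorr 3) 1 2 δ ![x 0, x 2] * rescaledCorrelator (criticalCorr 3) 1 2 δ ![x 1, x 3] +
            rescaledCorrelator (criticalCorr 3) 1 2 δ ![x 0, x 3] * rescaledCorrelator (criticalCorr 3) 1 2 δ ![x 1, x 2])|) :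
    ε * (S 2 ![x 0, x 1] * S 2 ![x 2, x 3]) ≤ |limitConnectedFour S x| := by
  obtain ⟨hU, hG⟩ := tendsto_U4_and_GG hlim hx
  by_contra hcon
  push Not at hcon
  -- the reverse strict inequality holds eventually after rescaling …
  have hev := hU.abs.eventually_lt (hG.const_mul ε) hcon
  -- … contradicting the frequent inequality
  have hboth := hfreq.and_eventually (hev.and eventually_mem_Ioc)
  obtain ⟨δ, hle, hlt, hmem⟩ := hboth.exists
  have hρ4 : 0 < ρ δ ^ 4 := pow_pos (hρ δ hmem) 4
  rw [abs_mul, abs_of_pos hρ4] at hlt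
  have key := mul_le_mul_of_nonneg_left hle hρ4.le
  linarith

end limit

/-! ### The route-level split: assembly and calibration -/

/-- **ASSEMBLY (typed decomposition of the crux).**
`LimitExists → NonGaussianLimit → NormalisedU4Nonvanishing`: existence of a non-degenerate pointwise
scaling limit of the critical correlators on `ℤ³` (item stmt-CriticalPhenomena-4738) and
non-Gaussianity of every such limit (item stmt-CriticalPhenomena-0636) give the crux
`NormalisedU4Nonvanishing` of route `CurrentConnectionInvariance` (item stmt-CriticalPhenomena-4843),
with the inequality holding EVENTUALLY (not only frequently) at the configuration where `U₄(S) ≠ 0`.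
[folklore] -/
theorem normalisedU4Nonvanishing_of_limit
    (hL : ∃ (ρ : ℝ → ℝ) (S : CorrFamily 3), (∀ δ ∈ Set.Ioc (0 : ℝ) 1, 0 < ρ δ) ∧
      HasPointwiseScalingLimit (criticalCorr 3) ρ S ∧ IsNondegenerateTwoPoint S)
    (hNG : ∀ (ρ : ℝ → ℝ) (S : CorrFamily 3), (∀ δ ∈ Set.Ioc (0 : ℝ) 1, 0 < ρ δ) →
      HasPointwiseScalingLimit (criticalCorr 3) ρ S → IsNondegenerateTwoPoint S → HasNontrivialU4 S) :
    NormalisedU4Nonvanishing := by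
  obtain ⟨ρ, S, hρ, hlim, hnd⟩ := hL
  obtain ⟨x, hx, hA⟩ := hNG ρ S hρ hlim hnd
  obtain ⟨ε, hε, hev⟩ := eventually_normalisedU4_of_limit hρ hlim hnd hx hA
  exact ⟨x, hx, ε, hε, hev.frequently⟩

/-- **CALIBRATION (the converse for the second piece).**  The crux implies item
stmt-CriticalPhenomena-0636: every non-degenerate pointwise scaling limit of the critical correlators
on `ℤ³` is non-Gaussian (`ε S₂S₂ ≤ |U₄(S)(x)|` at the crux's configuration). [folklore] -/
theorem nonGaussianLimit_of_normalisedU4Nonvanishing (h : NormalisedU4Nonvanishing) :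
    ∀ (ρ : ℝ → ℝ) (S : CorrFamily 3), (∀ δ ∈ Set.Ioc (0 : ℝ) 1, 0 < ρ δ) →
      HasPointwiseScalingLimit (criticalCorr 3) ρ S → IsNondegenerateTwoPoint S → HasNontrivialU4 S := by
  intro ρ S hρ hlim hnd
  obtain ⟨x, hx, ε, hε, hfreq⟩ := h
  have hxinj : Function.Injective x := hx
  have hle := le_abs_limitConnectedFour_of_frequently hρ hlim hx hfreq
  have hB : 0 < S 2 ![x 0, x 1] * S 2 ![x 2, x 3] :=
    mul_pos (hnd _ (injective_vecCons_pair (hxinj.ne (by decide))))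
      (hnd _ (injective_vecCons_pair (hxinj.ne (by decide))))
  refine ⟨x, hx, abs_pos.1 (lt_of_lt_of_le ?_ hle)⟩
  positivity


/-! ### This route's mechanism for piece 2: sourced double currents -/

/-- `NonGaussianLimit ⟸ (3.11)_∞ ∧ far merging of the sourced double currents` (sorry-free). [folklore] -/
theorem NonGaussianLimit_of (h1 : SwitchingInfiniteVolumeP) (h2 : SourcedCurrentsMergeIOP) :
    NonGaussianLimitP := by
  unfold NonGaussianLimitP
  obtain ⟨x, hx, c, hc, hio⟩ := h2
  refine farMergingGivesU4_proof ⟨2 * c, by positivity, x, hx, fun L₀ => ?_⟩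
  obtain ⟨L, hL, hcle⟩ := hio L₀
  refine ⟨L, hL, ?_⟩
  have hid := freeUrsellFour_eq_sourcedDoubleCurrent.criticalCorr_eq h1 (le_refl 3)
    ((L : ℤ) • x 0) ((L : ℤ) • x 1) ((L : ℤ) • x 2) ((L : ℤ) • x 3)
  have hfun : (fun i => (L : ℤ) • x i) = ![(L : ℤ) • x 0, (L : ℤ) • x 1, (L : ℤ) • x 2, (L : ℤ) • x 3] := by
    funext i; fin_cases i <;> rfl
  rw [hfun, hid]
  have hG : 0 ≤ criticalCorr 3 2 ![(L : ℤ) • x 0, (L : ℤ) • x 1] * criticalCorr 3 2 ![(L : ℤ) • x 2, (L : ℤ) • x 3] :=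
    mul_nonneg (criticalCorr_two_nonneg _ _) (criticalCorr_two_nonneg _ _)
  have key := mul_le_mul_of_nonneg_left hcle hG
  linarith

/-! ### The composition -/

/-- **The line concludes the crux BY NAME from exactly the three registered stubs** (sorry-free):
the split `LimitExists → NonGaussianLimit → crux` composed with this route's engine
`(3.11)_∞ → merging → NonGaussianLimit`. -/
theorem NormalisedU4Nonvanishing_of (h1 : Registered.stub_limitExists)
    (h2 : Registered.stub_switchingInfiniteVolume) (h3 : Registered.stub_sourcedCurrentsMergeIO) :
    Summit.CriticalPhenomena.Ising3DConformalLimit.Theses.CurrentConnectionInvariance.NormalisedU4Nonvanishing :=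
  normalisedU4Nonvanishing_of_limit h1 (NonGaussianLimit_of h2 h3)

/-! ### Consistency: each registered stub IS its name-keyed alias (definitionally), and the wiring -/
example : Registered.stub_limitExists := stub_limitExists
example : Registered.stub_switchingInfiniteVolume := stub_switchingInfiniteVolume
example : Registered.stub_sourcedCurrentsMergeIO := stub_sourcedCurrentsMergeIO
example : Summit.CriticalPhenomena.Ising3DConformalLimit.Theses.CurrentConnectionInvariance.NormalisedU4Nonvanishing :=
  NormalisedU4Nonvanishing_of stub_limitExists stub_switchingInfiniteVolume stub_sourcedCurrentsMergeIO
/-- The split alone, in the line vocabulary: `LimitExistsP → NonGaussianLimitP → crux`. -/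
example : LimitExistsP → NonGaussianLimitP →
    Summit.CriticalPhenomena.Ising3DConformalLimit.Theses.CurrentConnectionInvariance.NormalisedU4Nonvanishing :=
  fun hL hNG => normalisedU4Nonvanishing_of_limit hL hNG
/-- The converse calibration, in the line vocabulary: `crux → NonGaussianLimitP`. -/
example : Summit.CriticalPhenomena.Ising3DConformalLimit.Theses.CurrentConnectionInvariance.NormalisedU4Nonvanishing →
    NonGaussianLimitP := nonGaussianLimit_of_normalisedU4Nonvanishing

end Summit.CriticalPhenomena.Ising3DConformalLimit.Cruxes.NormalisedU4Nonvanishing.CurrentMergingSplit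

end
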